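/-
COR-CM (cells pub-hodgecm / pub-hodgecm2, stage 2 of the Hodge ladder) — TRANSPOSITION SURGE, item (vi) sub-binder S2, TEAM hComp,
CARRIERS-PLAN v1.2 §3 **S5**: Liu's §4.2 standing datum `C` over the honest Prop-C.5 datum `Model.honestP5Of h`, as a TOTAL TERM
`Model.sec42DataOf h iso : ∀ F ι₁ V Φ, Sec42Data (honestP5Of h F ι₁ V Φ) (iso F ι₁ V Φ)` — CONSTRUCTIVE at every face a display
reads (`4 ≤ [F:ℚ]`: Prop. C.5's system = the canonical-model record `honestSystemOf h`, Def. C.8 = b25's `compactifiedOf` (Compact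
Case), `A_K := Alb_{X_K}` chosen ONLY inside the cited existence theorem `exists_albanese`), and pin-1's punctured-plane inhabitant
elsewhere (`[F:ℚ] = 2`, never read).  Seat prover-pub-hodgecm2-pin-1-g3-0 (pin-1 gen 3, owner of record of `hComp`; CARRIERS-PLAN S5
writer); v3 = hAʹ-FREE re-cut on hcomp-abcm-1's `Liu2021/AlbaneseExistence.lean` (P3 chain, F4: [Liu2021] §2.1 Prop. 2.2 PROVED
for smooth projective schemes over number fields).  TWO DEFINITIONS + lemmas; the ONLY hypothesis binder is the named fact
`h : exists_recordSystem` ([Deligne1979] 2.2.5 / Cor. 2.7.21) — NO Albanese hypothesis.  Nothing landed is edited or restated; no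
display is re-cut here (S7 is pin-3's pen).  FRAMING: HC_CM is NOT proved; S2 is NOT closed.
-/
import Summits.HodgeConjecture.CorCM.B01.Transposition.HComp.HonestP5OfNonVacuityAll
import Literature.NumberTheory.Automorphic.Liu2021.AlbaneseExistence
import HarnessLib

/-!
# TEAM hComp, CARRIERS-PLAN S5: `Model.sec42DataOf` — the §4.2 carrier `C` as a total term over `honestP5Of h`

The END displays of the S2 pinning lane (`Model.hComp_holds` / `Model.pinReach_closed`, `Item6PinReachClosed.lean` p311503;
`Model.hc_cm_of_thm418AsPrinted_along_conj_holds`, `Item6SupplyPinnedAssemblyAlongHolds.lean` p311451 §3) quantify Liu's §4.2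
standing data as a POSITED Π-binder `C : ∀ F ι₁ V Φ, Sec42Data (honestP5Of h F ι₁ V Φ) (iso F ι₁ V Φ)` ([Liu2021] §4.2 l. 2053–2074:
Prop. C.5's system `Sh(𝕍)`, the projectivity clause, `X_K := S̃h(𝕍)_K` (Def. C.8), `A_K := Alb_{X_K}` (Def. 2.3)).  This file supplies
the term at which that binder can be INSTANTIATED BY APPLICATION (CARRIERS-PLAN v1.2 §3 S5 / §5, hcomp-lead C1, htheta-x2 g7
l.6844 «constructive `dite`» design):

* `Model.sec42DataOfFourLe h V Φ h4 iso` — for `4 ≤ [F:ℚ]`, EXPLICITLY b25's honest data (`HComp/HonestP5OfNonVacuity.lean`):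
  `S := honestSystemOf h V Φ` (Prop. C.5 CONSTRUCTED on Deligne's canonical models, `honestP5Of`), projectivity clause
  `isProjectiveOver_honestSystemOf_Sh_iff` (Compact Case, `d ≥ 2`), `cpt := compactifiedOf h V Φ h4` ([Liu2021] l. 4656 «if `Sh(𝕍)_K` is
  proper then `S̃h(𝕍)_K = Sh(𝕍)_K`»), `alb K :=` an Albanese datum of the proper smooth `X_K` from `exists_albanese` (the ONLY choice),
  transition morphisms by b11's `Sec42Data.ofAlbanese` (p301785);  projection lemmas `sec42DataOfFourLe_S`, `sec42DataOfFourLe_cpt` (`rfl`);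
* `nonempty_sec42Data_punctured_albFree` — the punctured-branch inhabitant of `HComp/HonestP5OfNonVacuityAll.lean`, re-derived
  WITHOUT `exists_albanese` (same `CompactifiedSystem`, closed by `Sec42Data.nonempty` of `Liu2021/AlbaneseExistence.lean`);
* `Model.sec42DataOf h iso : ∀ F ι₁ V Φ, Sec42Data (honestP5Of h F ι₁ V Φ) (iso F ι₁ V Φ)` — TOTAL: the former when `4 ≤ [F:ℚ]`, the
  punctured-branch inhabitant otherwise (`[F:ℚ] = 2`, read by no display: every hComp reading is guarded by `6 ≤ [F:ℚ]`);
  `sec42DataOf_eq_of_four_le` (`dif_pos`), `sec42DataOf_S`.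

Effect when consumed (S7, not here): `C := Model.sec42DataOf h iso` removes the posited binder `C` from the displays WITHOUT any new
hypothesis (the canonical models come from the already-displayed `h`); `hLiu` ([Liu2021] Thm. 4.18 as printed) is then read at Liu's own
`Sh(𝕍)_K = X_K`, `A_K` over the canonical-model datum.  The `variable (h …)`/`(hA …)` lines of earlier stagings are EXPLICIT binders here
(hcomp-lead RULING NV-R: disclosed).  T5: one Prop binder `h` (+ guards) — n/a unless t5-consist-1 wants a line.  HC_CM is NOT proved.

References: [Liu2021] Y. Liu, arXiv:2102.11518, §2.1 Prop. 2.2 / Def. 2.3 (l. 1190–1208), §4.2 l. 2053–2074, App. C Prop. C.5,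
l. 4656, Def. C.8; [Deligne1979] 2.2.5, Cor. 2.7.21.
-/

noncomputable section

open CategoryTheory AlgebraicGeometry NumberField
open Literature.AlgebraicGeometry.Motives
open Literature.AlgebraicGeometry.ShimuraVarieties.UnitaryCanonicalModel
open Literature.NumberTheory.Automorphic
open Literature.NumberTheory.Automorphic.Liu2021
open Literature.NumberTheory.Automorphic.Liu2021.AppendixC
open Summit.HodgeConjecture.CorCM.HComp
open Summit.HodgeConjecture.CorCM.HComp.PuncturedPlane

namespace Summit.HodgeConjecture.CorCM.Model

section FourLe

/-- **Liu's §4.2 standing datum over the honest datum, EXPLICIT, for `4 ≤ [F:ℚ]`** (Compact Case): Prop. C.5's system is the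
canonical-model record system `honestSystemOf h V Φ`, «projective iff Compact Case» holds with both sides true (`d = [F⁺:ℚ] ≥ 2`),
Def. C.8 is `compactifiedOf h V Φ h4` (`S̃h = Sh`), the Albanese data `A_K := Alb_{X_K}` of the proper smooth `X_K` are chosen from
hcomp-abcm-1's theorem `Albanese.nonempty_of_numberField` ([Liu2021] §2.1 Prop. 2.2, PROVED for smooth projective schemes over number
fields), and `∇u`, `Alb_u` are b11's kernel constructions (`Sec42Data.ofAlbanese`).  The explicit, Albanese-hypothesis-free form of b25's
`nonempty_sec42Data_honestP5Of`.  CONDITIONAL on `h` only; HC_CM is NOT proved.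
[cite: Liu2021, §4.2 l. 2053–2074, §2.1 Prop. 2.2 l. 1190–1200, App. C l. 4656 and Def. C.8] [cite: Deligne1979ShimuraVarieties, 2.2.5 and Cor. 2.7.21] -/
def sec42DataOfFourLe (h : exists_recordSystem) {F : CMField} {ι₁ : F →+* ℂ} (V : HermSpace3 F ι₁)
    (Φ : Literature.AlgebraicGeometry.Motives.CMType F) (h4 : 4 ≤ Module.finrank ℚ F) (iso : ℕ → Prop) :
    Sec42Data (honestP5Of h F ι₁ V Φ) iso :=
  Sec42Data.ofAlbanese (Nat.le_of_ble_eq_true rfl) (honestSystemOf h V Φ)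
    (isProjectiveOver_honestSystemOf_Sh_iff h V Φ h4 iso) (compactifiedOf h V Φ h4) fun K =>
      haveI := (compactifiedOf h V Φ h4).smooth_X K
      Classical.choice
        (Albanese.nonempty_of_numberField (d := (honestP5Of h F ι₁ V Φ).n - 1) ((compactifiedOf h V Φ h4).X.obj K)
          ((compactifiedOf h V Φ h4).projective_X K))

/-- Its Prop.-C.5 system IS `honestSystemOf h V Φ` (by `rfl`). [cite: Liu2021, Prop. C.5 l. 4627–4633] -/
theorem sec42DataOfFourLe_S (h : exists_recordSystem) {F : CMField} {ι₁ : F →+* ℂ} (V : HermSpace3 F ι₁)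
    (Φ : Literature.AlgebraicGeometry.Motives.CMType F) (h4 : 4 ≤ Module.finrank ℚ F) (iso : ℕ → Prop) :
    (sec42DataOfFourLe h V Φ h4 iso).S = honestSystemOf h V Φ := rfl

/-- Its compactified system IS b25's `compactifiedOf h V Φ h4` (`X_K = Sh(𝕍)_K`; by `rfl`). [cite: Liu2021, App. C l. 4656 and Def. C.8] -/
theorem sec42DataOfFourLe_cpt (h : exists_recordSystem) {F : CMField} {ι₁ : F →+* ℂ} (V : HermSpace3 F ι₁)
    (Φ : Literature.AlgebraicGeometry.Motives.CMType F) (h4 : 4 ≤ Module.finrank ℚ F) (iso : ℕ → Prop) :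
    (sec42DataOfFourLe h V Φ h4 iso).cpt = compactifiedOf h V Φ h4 := rfl

/-- Hence its `X_K` is the honest `Sh(𝕍)_K = M_K ⊗_{F,c} F` on the nose (by `rfl`). [cite: Liu2021, §4.2 l. 2062 and App. C l. 4656] -/
theorem sec42DataOfFourLe_X (h : exists_recordSystem) {F : CMField} {ι₁ : F →+* ℂ} (V : HermSpace3 F ι₁)
    (Φ : Literature.AlgebraicGeometry.Motives.CMType F) (h4 : 4 ≤ Module.finrank ℚ F) (iso : ℕ → Prop)
    (K : C5.SmallLevel (K3 V)) : (sec42DataOfFourLe h V Φ h4 iso).X K = (honestSystemOf h V Φ).Sh𝕍.obj K := rfl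

end FourLe

/-- **The punctured-branch inhabitant WITHOUT `exists_albanese`** (`[F⁺:ℚ] = 1`): the `CompactifiedSystem` of
`Model.nonempty_sec42Data_punctured` (`HComp/HonestP5OfNonVacuityAll.lean`: `X_K := ℙ²_F ⊗_c F`, the base-changed open immersion,
one boundary point — Def. C.8 AS TYPED, not Liu's toroidal compactification), closed by hcomp-abcm-1's `Sec42Data.nonempty`
(`Liu2021/AlbaneseExistence.lean`: the Albanese data EXIST for smooth projective `X_K` over a number field).
[cite: Liu2021, §4.2 l. 2053–2072, §2.1 Prop. 2.2 l. 1190–1200, App. C l. 4656–4670, Def. C.8] -/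
theorem nonempty_sec42Data_punctured_albFree {F : CMField} {ι₁ : F →+* ℂ} (V : HermSpace3 F ι₁)
    (K₀ : C5.OpenCompactSubgroup ↥V.adelicFin) (hd : Module.finrank ℚ (maximalRealSubfield F) = 1) (iso : ℕ → Prop) :
    Nonempty (Sec42Data (honestP5 V K₀ ((Functor.const _).obj (puncturedPlane F))) iso) := by
  -- the open immersion `ℙ² ∖ pt ↪ ℙ²` over `F` (one boundary point), and its base change along `c`
  obtain ⟨ιU, hιU, hbd₀⟩ := exists_openImmersion_puncturedPlane F
  have hbd : ((Set.range ((baseChangeHom (cmConjRingHom F)).map ιU).left)ᶜ).Subsingleton :=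
    subsingleton_compl_range_baseChange_map ιU hbd₀
  let cpt : CompactifiedSystem (honestSystem V K₀ ((Functor.const _).obj (puncturedPlane F))) :=
    { ShBar := fun _ => (baseChangeHom (cmConjRingHom F)).obj (projectiveSpace 2 (F : Type))
      jBar := fun _ => (baseChangeHom (cmConjRingHom F)).map ιU
      isOpenImmersion_jBar := fun _ => isOpenImmersion_baseChange_map_left ιU
      discrete_boundary := fun _ => @Subsingleton.discreteTopology _ _ hbd.coe_sort
      X := conjSystem V K₀ ((Functor.const _).obj (projectiveSpace 2 (F : Type)))
      blowDown := fun _ => 𝟙 _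
      j := Functor.whiskerRight ((Functor.const _).map ιU) (baseChangeHom (cmConjRingHom F))
      j_blowDown := fun _ => Category.comp_id _
      isOpenImmersion_j := fun _ => isOpenImmersion_baseChange_map_left ιU
      isIso_j_of_isProper := fun _ hK => absurd hK (not_isProper_baseChange_cmConj (not_isProper_puncturedPlane F))
      smooth_Sh := fun K =>
        smooth_conjSystem_obj V K₀ ((Functor.const _).obj (puncturedPlane F)) (fun _ => smooth_puncturedPlane F) K
      projective_Sh_of := fun hdn K => by
        exfalso
        rcases hdn with h1 | h1
        · rw [hd] at h1
          exact lt_irrefl _ h1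
        · have h3 : (honestP5 V K₀ ((Functor.const (C5.SmallLevel K₀)).obj (puncturedPlane F))).n = 3 := rfl
          omega
      smooth_X := fun K =>
        smooth_conjSystem_obj V K₀ ((Functor.const _).obj (projectiveSpace 2 (F : Type)))
          (fun _ => smooth_projectiveSpace_two F) K
      projective_X := fun K =>
        projective_conjSystem_obj V K₀ ((Functor.const _).obj (projectiveSpace 2 (F : Type)))
          (fun _ => isProjectiveOver_projectiveSpace_two F) K }
  exact Sec42Data.nonempty iso (Nat.le_of_ble_eq_true rfl)
    (honestSystem V K₀ ((Functor.const _).obj (puncturedPlane F))) (isProjectiveOver_punctured_Sh_iff V K₀ hd iso) cpt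


/-- **`Model.sec42DataOf h iso` — Liu's §4.2 carrier `C` over the honest datum, as a TOTAL function of `(F, ι₁, V, Φ)`** (the
shape of the Π-binder `C` of the END displays, NO degree guard): `sec42DataOfFourLe` when `4 ≤ [F:ℚ]` (every face a display reads has
`6 ≤ [F:ℚ]`), and pin-1's punctured-branch inhabitant otherwise (`[F:ℚ] = 2`, read by no display).  CONDITIONAL on `h` only; HC_CM is NOT proved; instantiating `C` at this term is the consumer's act (CARRIERS-PLAN S7), not done here.
[cite: Liu2021, §4.2 l. 2053–2074 and §2.1 Prop. 2.2] [cite: Deligne1979ShimuraVarieties, 2.2.5 and Cor. 2.7.21] -/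
def sec42DataOf (h : exists_recordSystem)
    (iso : ∀ (F : CMField) (ι₁ : F →+* ℂ) (_ : HermSpace3 F ι₁) (_ : Literature.AlgebraicGeometry.Motives.CMType F), ℕ → Prop)
    (F : CMField) (ι₁ : F →+* ℂ) (V : HermSpace3 F ι₁) (Φ : Literature.AlgebraicGeometry.Motives.CMType F) :
    Sec42Data (honestP5Of h F ι₁ V Φ) (iso F ι₁ V Φ) :=
  if h4 : 4 ≤ Module.finrank ℚ F then sec42DataOfFourLe h V Φ h4 (iso F ι₁ V Φ)
  else Classical.choice (by
    show Nonempty (Sec42Data (honestP5 V (K3 V) (recordFunctorOf h V)) (iso F ι₁ V Φ))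
    rw [recordFunctorOf_eq_punctured V h h4]
    exact nonempty_sec42Data_punctured_albFree V (K3 V) (finrank_maximalRealSubfield_eq_one h4) (iso F ι₁ V Φ))

/-- At every `F` with `4 ≤ [F:ℚ]` (so at every face a display reads) the total carrier IS the explicit one (`dif_pos`).
[cite: Liu2021, §4.2 l. 2053–2074] -/
theorem sec42DataOf_eq_of_four_le (h : exists_recordSystem) {F : CMField} {ι₁ : F →+* ℂ} (V : HermSpace3 F ι₁)
    (Φ : Literature.AlgebraicGeometry.Motives.CMType F)
    (iso : ∀ (F : CMField) (ι₁ : F →+* ℂ) (_ : HermSpace3 F ι₁) (_ : Literature.AlgebraicGeometry.Motives.CMType F), ℕ → Prop) (h4 : 4 ≤ Module.finrank ℚ F) :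
    sec42DataOf h iso F ι₁ V Φ = sec42DataOfFourLe h V Φ h4 (iso F ι₁ V Φ) :=
  dif_pos h4

/-- … so its Prop.-C.5 system is the canonical-model record system `honestSystemOf h V Φ`. [cite: Liu2021, Prop. C.5 l. 4627–4633] -/
theorem sec42DataOf_S (h : exists_recordSystem) {F : CMField} {ι₁ : F →+* ℂ} (V : HermSpace3 F ι₁)
    (Φ : Literature.AlgebraicGeometry.Motives.CMType F)
    (iso : ∀ (F : CMField) (ι₁ : F →+* ℂ) (_ : HermSpace3 F ι₁) (_ : Literature.AlgebraicGeometry.Motives.CMType F), ℕ → Prop) (h4 : 4 ≤ Module.finrank ℚ F) :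
    (sec42DataOf h iso F ι₁ V Φ).S = honestSystemOf h V Φ := by
  rw [sec42DataOf_eq_of_four_le h V Φ iso h4]
  rfl

/-- … and at every face the chain reads (`6 ≤ [F:ℚ]`). [cite: Liu2021, §4.2 l. 2053–2074] -/
theorem sec42DataOf_eq_of_six_le (h : exists_recordSystem) {F : CMField} {ι₁ : F →+* ℂ} (V : HermSpace3 F ι₁)
    (Φ : Literature.AlgebraicGeometry.Motives.CMType F)
    (iso : ∀ (F : CMField) (ι₁ : F →+* ℂ) (_ : HermSpace3 F ι₁) (_ : Literature.AlgebraicGeometry.Motives.CMType F), ℕ → Prop) (h6 : 6 ≤ Module.finrank ℚ F) :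
    sec42DataOf h iso F ι₁ V Φ = sec42DataOfFourLe h V Φ (le_trans (by norm_num) h6) (iso F ι₁ V Φ) :=
  dif_pos _

end Summit.HodgeConjecture.CorCM.Model

end
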